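import Summits.HodgeConjecture.HodgeConjecture.Theorems.F0P3cStCharTSUpTrJacobian   -- ★ (H3e) (F0P3a-p02 g24) JAC-BY-SHAPE: generic `integral_cartanSet_eq_of_tubeJacobian_local` (first conjunct = product integrability) + `H_v` letters `isClosed_cartanH`
import Summits.HodgeConjecture.HodgeConjecture.Theorems.F0P3cStCharTSUpTrCartanFields  -- ★ (H3b) (LH4-p01 g8) CARTAN-FIELDS-H: `isClosed_cartan` (the (H5) assembler's closedness witness)
import HarnessLib

/-!
# F0 · P3c · line LH6 «StCharTS» — ROAD «UP-TR» (A0-H) «INTEGRABILITY», GENERIC AND ON THE ENDOSCOPIC GROUP `H_v`: THE TORUS-SIDE TERMS OF A WEYL INTEGRATION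
# FORMULA ARE INTEGRABLE AS SOON AS THE GROUP-SIDE INTEGRAND IS (Rogawski 1990 §12.5 pp. 182–183; Harish-Chandra 1970 Lemma 42)

Cell `pub/hodgecm-mathlib`, crux H413 = `stmt-HodgeConjecture-24833` (lane `--supports`, helper); seat F0P2-p01 (g23); ROAD «UP-TR» (LEAD T14-21 «A»; holder ∕ dealer
F0P3-p02 (g23)); brick (A0), `H`-side twin of ★ p852383 `F0P3cStCharTSUpTrTorusIntegrable` (CENSUS-A0 v1.1).  THEOREMS ONLY; sorry-free; no definition ∕ instance ∕ notation ∕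
named fact; ★-only imports; axioms TRIO.

WHY.  The (H5) WIF-H assembler ★ `F0P3cStCharTSUpTrWIFH` consumes the per-Cartan Bochner identity BY SHAPE (`hJacInt`, equation only), so the integrability of the torus terms on the
`H` side — needed by (H6b′) SWIF-H ∕ (A1′) to transport and add those terms as Bochner integrals (CENSUS-A0 §4: at TORUS level, never below) — is a separate fact.  It is PRODUCED
here from group-side integrability alone, exactly as on `G`: the first conjunct of ★ (H3e) `F0P3cStCharTSUpTrJacobian.integral_cartanSet_eq_of_tubeJacobian_local` (product
integrability of `(t, q) ↦ g(Φ(q,t))` for `(D · tm|_{T ∩ R}) ⊗ μ₀`) read through Mathlib's `Integrable.integral_prod_left` ∕ `integrable_withDensity_iff_integrable_coe_smul` ∕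
`Integrable.prod_right_ae` ∕ `ae_withDensity_iff`.

CONTENT (letters and the local tube-Jacobian socket `hJacLoc` VERBATIM those of ★ (H3e) §2 (generic `(G, R, T)`) and §3 (`H_v = U(Φ₂)(L⁺_v) × U(Φ₁)(L⁺_v)`, `R = {G-regular}`,
`T = Z_H(γ₀)`, closedness witness `isClosed_cartanH hT`)):
* §1 generic — `integrableOn_weighted_orbital_of_integrableOn`: `g` integrable on `G_T = {x t x⁻¹ | t ∈ T ∩ R}` ⇒ `t ↦ D t • ∫_{G⧸T} g(Φ(q,t)) dμ₀` integrable on `T ∩ R` for `tm`;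
  `ae_integrable_orbital_of_integrableOn`: for `tm`-a.e. `t ∈ T ∩ R` with `D t ≠ 0` the orbital integral of `g` at `t` converges; `integrableOn_weighted_classFun_mul_orbital`: the
  class-function form `g = f · α`, `α(x t x⁻¹) = α(t)` on `R`.
* §2 on `H_v` — `integrableOn_weighted_orbital_of_integrableOn_H`, `integrableOn_weighted_classFun_mul_orbital_H`: the same in ★ (H3e)
  §3's letters (`hRc hRo hab hZ hW` by shape, as there), i.e. in the currency of the (H5) assembler's `hJacInt` letter and of ★ `setIntegral_weighted_orbital_eq_smul_setIntegral_cartanSetH`.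
* §3 `ι`-indexed, (H5)'s currency — `integrableOn_weighted_classOrbitalIntegral_of_integrable_H`: with the `hOrb` letter by shape and the closedness witness ★ (H3b) `isClosed_cartan (hT i)`
  exactly as ★ `F0P3cStCharTSUpTrWIFH.integral_mul_classFun_eq_sum_classOrbitalIntegral_H_of_shape`, term `i` of that formula, `t ↦ D i t • (α t · classOrbitalIntegral mHv fH ⟦t⟧)`, is
  `t_{T i}`-integrable on `{t ∈ T i | G-regular}` — the `hIntT` letter of (H6b′) SWIF-H ∕ (A1′), token for token.
HONEST LABEL: count-neutral; block consequents 11 → 10 → 9 only at the rider editions; organs 2 = 2; h413 registry untouched; HC_CM is proved only modulo the printed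
citations until rung 0 closes.

## References
* [Rogawski1990] J. D. Rogawski, *Automorphic Representations of Unitary Groups in Three Variables*, Ann. of Math. Stud. 123 (1990), §12.5 pp. 182–183 (Weyl integration
  formula on `G` and on `H`; Lemma 12.5.1).
* [HarishChandra1970] Harish-Chandra (notes by G. van Dijk), *Harmonic analysis on reductive p-adic groups*, LNM 162 (1970), Lemma 22, Lemma 42.
-/

set_option autoImplicit false
-- the mandated namespace has the single-problem summit's repeated segment (`HodgeConjecture.HodgeConjecture`)
set_option linter.dupNamespace false

noncomputable section

open MeasureTheory Measure Set Filter Topology Function NumberField IsDedekindDomain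
open Literature.MeasureTheory.Group
open Literature.NumberTheory.Automorphic Literature.NumberTheory.Rogawski1990
open Summit.HodgeConjecture.HodgeConjecture.Cruxes.H413.F0P3cStCharTSWeylHypMeasure
open Summit.HodgeConjecture.HodgeConjecture.Cruxes.H413.F0P3cStCharTSUpTrJacobian
open scoped ENNReal NNReal MatrixGroups Pointwise

namespace Summit.HodgeConjecture.HodgeConjecture.Cruxes.H413.F0P3cStCharTSUpTrTorusIntegrableH

/-! ## §1 Generic `(G, R, T)`: torus-side integrability from integrability on the `T`-regular set -/

section Generic

variable {G : Type*} [Group G] [TopologicalSpace G] [IsTopologicalGroup G] [LocallyCompactSpace G]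
  [SecondCountableTopology G] [T2Space G] [MeasurableSpace G] [BorelSpace G]
  {R : Set G} (hRm : MeasurableSet R) (hRc : ∀ g x : G, x ∈ R → g * x * g⁻¹ ∈ R)
  {T : Subgroup G} (hT : IsClosed (T : Set G)) (hTc : ∀ a ∈ T, ∀ b ∈ T, a * b = b * a)
  (hRT : ∀ t : ↥T, (t : G) ∈ R → Subgroup.centralizer ({(t : G)} : Set G) = T)
  (hW : (T.subgroupOf (Subgroup.normalizer (T : Set G))).index ≠ 0)
  (Φ : (G ⧸ T) × ↥T → G) (hΦ : ∀ (x : G) (t : ↥T), Φ (QuotientGroup.mk x, t) = x * t * x⁻¹)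
  [MeasurableSpace (G ⧸ T)] [BorelSpace (G ⧸ T)]
  (ν : Measure G) [ν.IsHaarMeasure] [ν.IsMulRightInvariant]
  (tm : Measure ↥T) [tm.IsMulLeftInvariant] [IsFiniteMeasureOnCompacts tm] [tm.IsOpenPosMeasure] [tm.IsInvInvariant]
  (D : ↥T → ℝ≥0) (hD : Measurable D)

set_option maxHeartbeats 1600000 in
-- instance-term unification for `quotientMeasure` with its σ-algebra arguments (as ★ (H3e))
include hRm hRc hTc hRT hW hΦ hD in
/-- **(A0) TORUS-SIDE INTEGRABILITY FROM GROUP-SIDE INTEGRABILITY (generic).**  `G` locally compact second-countable Hausdorff with Haar `ν`; `R ⊆ G` Borel, conjugation-invariant;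
`T ≤ G` closed abelian with `Z(t) = T` on `T ∩ R` and `[N(T):T] ≠ 0`; `Φ(xT, t) = x t x⁻¹`; `tm` Haar on `T`, `μ₀ = ν∕tm`; `D : T → ℝ≥0` measurable; local tube-Jacobian socket `hJacLoc`
(★ (H3e) §1∕§2).  If `g : G → ℂ` is `ν`-integrable on `G_T = {x t x⁻¹ | t ∈ T ∩ R}` then **`t ↦ D(t) • ∫_{G⧸T} g(Φ(q,t)) dμ₀` is `tm`-integrable on `T ∩ R`** (first conjunct of ★
`integral_cartanSet_eq_of_tubeJacobian_local`, `Integrable.integral_prod_left`, `integrable_withDensity_iff_integrable_coe_smul`). [cite: Rogawski1990, §12.5 p. 182] [cite: HarishChandra1970, Lemma 42] -/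
theorem integrableOn_weighted_orbital_of_integrableOn
    (hJacLoc : ∀ t₀ : ↥T, (t₀ : G) ∈ R →
      ∃ U : Set ↥T, IsOpen U ∧ t₀ ∈ U ∧
        ∃ A₀ : Set (G ⧸ T), MeasurableSet A₀ ∧ (quotientMeasure T tm hT ν) A₀ ≠ 0 ∧ (quotientMeasure T tm hT ν) A₀ ≠ ∞ ∧
          ∀ V : Set ↥T, MeasurableSet V → V ⊆ U → (∀ t ∈ V, (t : G) ∈ R) →
            (∀ n : G, n ∉ T → ∀ t ∈ V, ∀ t' ∈ V, ((t' : ↥T) : G) ≠ n * t * n⁻¹) →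
              ν (Φ '' (A₀ ×ˢ V)) = (quotientMeasure T tm hT ν) A₀ * ∫⁻ t in V, (D t : ℝ≥0∞) ∂tm)
    (g : G → ℂ) (hg : IntegrableOn g {x | ∃ g t : G, t ∈ T ∧ t ∈ R ∧ g * t * g⁻¹ = x} ν) :
    IntegrableOn (fun t : ↥T => (D t : ℝ) • ∫ q, g (Φ (q, t)) ∂(quotientMeasure T tm hT ν)) {t : ↥T | (t : G) ∈ R} tm := by
  obtain ⟨hint, -⟩ := integral_cartanSet_eq_of_tubeJacobian_local hRm hRc hT hTc hRT hW Φ hΦ ν tm D hD hJacLoc g hg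
  haveI : IsClosed (T : Set G) := hT
  haveI : SecondCountableTopology (G ⧸ T) := (QuotientGroup.isQuotientMap_mk _).secondCountableTopology QuotientGroup.isOpenMap_coe
  haveI : LocallyCompactSpace (G ⧸ T) := QuotientGroup.instLocallyCompactSpace _
  haveI : SigmaCompactSpace (G ⧸ T) := sigmaCompactSpace_of_locallyCompact_secondCountable
  haveI : SigmaFinite (quotientMeasure T tm hT ν) := SigmaFinite.of_isFiniteMeasureOnCompacts _
  exact (integrable_withDensity_iff_integrable_coe_smul hD).1 hint.integral_prod_left

set_option maxHeartbeats 1600000 in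
-- instance-term unification for `quotientMeasure`, as above
include hRm hRc hTc hRT hW hΦ hD in
/-- **(A0) THE ORBITAL INTEGRAL CONVERGES AT ALMOST EVERY REGULAR POINT OF POSITIVE WEIGHT (generic)**: under the same socket, if `g` is `ν`-integrable on `G_T` then for
`tm`-a.e. `t ∈ T ∩ R` with `D(t) ≠ 0`, `q ↦ g(Φ(q,t))` is `μ₀`-integrable (`Integrable.prod_right_ae`, `ae_withDensity_iff`). [cite: Rogawski1990, §12.5 p. 182] [cite: HarishChandra1970, Lemma 42] -/
theorem ae_integrable_orbital_of_integrableOn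
    (hJacLoc : ∀ t₀ : ↥T, (t₀ : G) ∈ R →
      ∃ U : Set ↥T, IsOpen U ∧ t₀ ∈ U ∧
        ∃ A₀ : Set (G ⧸ T), MeasurableSet A₀ ∧ (quotientMeasure T tm hT ν) A₀ ≠ 0 ∧ (quotientMeasure T tm hT ν) A₀ ≠ ∞ ∧
          ∀ V : Set ↥T, MeasurableSet V → V ⊆ U → (∀ t ∈ V, (t : G) ∈ R) →
            (∀ n : G, n ∉ T → ∀ t ∈ V, ∀ t' ∈ V, ((t' : ↥T) : G) ≠ n * t * n⁻¹) →
              ν (Φ '' (A₀ ×ˢ V)) = (quotientMeasure T tm hT ν) A₀ * ∫⁻ t in V, (D t : ℝ≥0∞) ∂tm)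
    (g : G → ℂ) (hg : IntegrableOn g {x | ∃ g t : G, t ∈ T ∧ t ∈ R ∧ g * t * g⁻¹ = x} ν) :
    ∀ᵐ t ∂(tm.restrict {t : ↥T | (t : G) ∈ R}), D t ≠ 0 → Integrable (fun q => g (Φ (q, t))) (quotientMeasure T tm hT ν) := by
  obtain ⟨hint, -⟩ := integral_cartanSet_eq_of_tubeJacobian_local hRm hRc hT hTc hRT hW Φ hΦ ν tm D hD hJacLoc g hg
  haveI : IsClosed (T : Set G) := hT
  haveI : SecondCountableTopology (G ⧸ T) := (QuotientGroup.isQuotientMap_mk _).secondCountableTopology QuotientGroup.isOpenMap_coe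
  haveI : LocallyCompactSpace (G ⧸ T) := QuotientGroup.instLocallyCompactSpace _
  haveI : SigmaCompactSpace (G ⧸ T) := sigmaCompactSpace_of_locallyCompact_secondCountable
  haveI : SigmaFinite (quotientMeasure T tm hT ν) := SigmaFinite.of_isFiniteMeasureOnCompacts _
  haveI : SecondCountableTopology ↥T := TopologicalSpace.Subtype.secondCountableTopology _
  haveI : LocallyCompactSpace ↥T := hT.isClosedEmbedding_subtypeVal.locallyCompactSpace
  haveI : SigmaCompactSpace ↥T := sigmaCompactSpace_of_locallyCompact_secondCountable
  haveI : SigmaFinite tm := SigmaFinite.of_isFiniteMeasureOnCompacts _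
  haveI : SigmaFinite ((tm.restrict {t : ↥T | (t : G) ∈ R}).withDensity fun t => (D t : ℝ≥0∞)) :=
    SigmaFinite.withDensity_of_ne_top (ae_of_all _ fun _ => ENNReal.coe_ne_top)
  have h1 := hint.prod_right_ae
  rw [ae_withDensity_iff hD.coe_nnreal_ennreal] at h1
  filter_upwards [h1] with t ht hDt
  exact ht (by exact_mod_cast hDt)

set_option maxHeartbeats 1600000 in
-- instance-term unification for `quotientMeasure`, as above
include hRm hRc hTc hRT hW hΦ hD in
/-- **(A0) CLASS-FUNCTION FORM (generic)**: for `f α : G → ℂ` with `α(x t x⁻¹) = α(t)` for `t ∈ R` and `f · α` `ν`-integrable on `G_T`, **`t ↦ D(t) • (α(t) · ∫_{G⧸T} f(Φ(q,t)) dμ₀)`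
is `tm`-integrable on `T ∩ R`** (§1 and the pointwise identity `∫ f(Φ(q,t)) α(Φ(q,t)) dμ₀ = α(t) · ∫ f(Φ(q,t)) dμ₀` on `T ∩ R`). [cite: Rogawski1990, §12.5 p. 182] [cite: HarishChandra1970, Lemma 42] -/
theorem integrableOn_weighted_classFun_mul_orbital
    (hJacLoc : ∀ t₀ : ↥T, (t₀ : G) ∈ R →
      ∃ U : Set ↥T, IsOpen U ∧ t₀ ∈ U ∧
        ∃ A₀ : Set (G ⧸ T), MeasurableSet A₀ ∧ (quotientMeasure T tm hT ν) A₀ ≠ 0 ∧ (quotientMeasure T tm hT ν) A₀ ≠ ∞ ∧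
          ∀ V : Set ↥T, MeasurableSet V → V ⊆ U → (∀ t ∈ V, (t : G) ∈ R) →
            (∀ n : G, n ∉ T → ∀ t ∈ V, ∀ t' ∈ V, ((t' : ↥T) : G) ≠ n * t * n⁻¹) →
              ν (Φ '' (A₀ ×ˢ V)) = (quotientMeasure T tm hT ν) A₀ * ∫⁻ t in V, (D t : ℝ≥0∞) ∂tm)
    (f α : G → ℂ) (hα : ∀ x t : G, t ∈ R → α (x * t * x⁻¹) = α t)
    (hfα : IntegrableOn (fun y => f y * α y) {x | ∃ g t : G, t ∈ T ∧ t ∈ R ∧ g * t * g⁻¹ = x} ν) :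
    IntegrableOn (fun t : ↥T => (D t : ℝ) • (α (t : G) * ∫ q, f (Φ (q, t)) ∂(quotientMeasure T tm hT ν))) {t : ↥T | (t : G) ∈ R} tm := by
  have h1 := integrableOn_weighted_orbital_of_integrableOn hRm hRc hT hTc hRT hW Φ hΦ ν tm D hD hJacLoc (fun y => f y * α y) hfα
  have hSm : MeasurableSet {t : ↥T | (t : G) ∈ R} := measurable_subtype_coe hRm
  refine h1.congr_fun (fun t ht => ?_) hSm
  have hpt : ∀ q : G ⧸ T, f (Φ (q, t)) * α (Φ (q, t)) = f (Φ (q, t)) * α (t : G) := by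
    intro q
    induction q using QuotientGroup.induction_on with
    | H x => rw [hΦ x t, hα x (t : G) ht]
  show (D t : ℝ) • ∫ q, f (Φ (q, t)) * α (Φ (q, t)) ∂(quotientMeasure T tm hT ν) = _
  simp_rw [hpt]
  rw [integral_mul_const, mul_comm]

end Generic

/-! ## §2 The endoscopic group `H_v = U(Φ₂)(L⁺_v) × U(Φ₁)(L⁺_v)`, `R = {G-regular}`, `T = Z_H(γ₀)` — ★ (H3e) §3's letters -/

section Endoscopic

variable {L : Type} [Field L] [NumberField L] [IsCMField L] {v : HeightOneSpectrum (𝓞 ↥(maximalRealSubfield L))}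
  {T : Subgroup (((UnitaryGroup.cmDatum L 2 (Matrix.of fun i j : Fin 2 => if i.val + j.val + 1 = 2 then (1 : L) else 0)).Local v ×
      (UnitaryGroup.cmDatum L 1 (Matrix.of fun i j : Fin 1 => if i.val + j.val + 1 = 1 then (1 : L) else 0)).Local v))}
  {γ₀ : ((UnitaryGroup.cmDatum L 2 (Matrix.of fun i j : Fin 2 => if i.val + j.val + 1 = 2 then (1 : L) else 0)).Local v ×
      (UnitaryGroup.cmDatum L 1 (Matrix.of fun i j : Fin 1 => if i.val + j.val + 1 = 1 then (1 : L) else 0)).Local v)}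
  (hT : T = Subgroup.centralizer ({γ₀} : Set _))
  -- (H3b) ∕ (H3a) letters by shape, as in ★ (H3e) §3
  (hRc : ∀ g s : ((UnitaryGroup.cmDatum L 2 (Matrix.of fun i j : Fin 2 => if i.val + j.val + 1 = 2 then (1 : L) else 0)).Local v ×
      (UnitaryGroup.cmDatum L 1 (Matrix.of fun i j : Fin 1 => if i.val + j.val + 1 = 1 then (1 : L) else 0)).Local v),
    IsLocalGRegular L v s → IsLocalGRegular L v (g * s * g⁻¹))
  (hRo : IsOpen {s : ((UnitaryGroup.cmDatum L 2 (Matrix.of fun i j : Fin 2 => if i.val + j.val + 1 = 2 then (1 : L) else 0)).Local v ×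
      (UnitaryGroup.cmDatum L 1 (Matrix.of fun i j : Fin 1 => if i.val + j.val + 1 = 1 then (1 : L) else 0)).Local v) | IsLocalGRegular L v s})
  (hab : ∀ a ∈ T, ∀ b ∈ T, a * b = b * a)
  (hZ : ∀ t : ↥T, IsLocalGRegular L v (t : ((UnitaryGroup.cmDatum L 2 (Matrix.of fun i j : Fin 2 => if i.val + j.val + 1 = 2 then (1 : L) else 0)).Local v ×
      (UnitaryGroup.cmDatum L 1 (Matrix.of fun i j : Fin 1 => if i.val + j.val + 1 = 1 then (1 : L) else 0)).Local v)) →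
    Subgroup.centralizer ({(t : ((UnitaryGroup.cmDatum L 2 (Matrix.of fun i j : Fin 2 => if i.val + j.val + 1 = 2 then (1 : L) else 0)).Local v ×
      (UnitaryGroup.cmDatum L 1 (Matrix.of fun i j : Fin 1 => if i.val + j.val + 1 = 1 then (1 : L) else 0)).Local v))} : Set _) = T)
  (hW : (T.subgroupOf (Subgroup.normalizer (T : Set (((UnitaryGroup.cmDatum L 2 (Matrix.of fun i j : Fin 2 => if i.val + j.val + 1 = 2 then (1 : L) else 0)).Local v ×
      (UnitaryGroup.cmDatum L 1 (Matrix.of fun i j : Fin 1 => if i.val + j.val + 1 = 1 then (1 : L) else 0)).Local v))))).index ≠ 0)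
  (Φ : ((((UnitaryGroup.cmDatum L 2 (Matrix.of fun i j : Fin 2 => if i.val + j.val + 1 = 2 then (1 : L) else 0)).Local v ×
      (UnitaryGroup.cmDatum L 1 (Matrix.of fun i j : Fin 1 => if i.val + j.val + 1 = 1 then (1 : L) else 0)).Local v)) ⧸ T) × ↥T →
    ((UnitaryGroup.cmDatum L 2 (Matrix.of fun i j : Fin 2 => if i.val + j.val + 1 = 2 then (1 : L) else 0)).Local v ×
      (UnitaryGroup.cmDatum L 1 (Matrix.of fun i j : Fin 1 => if i.val + j.val + 1 = 1 then (1 : L) else 0)).Local v))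
  (hΦ : ∀ (x : ((UnitaryGroup.cmDatum L 2 (Matrix.of fun i j : Fin 2 => if i.val + j.val + 1 = 2 then (1 : L) else 0)).Local v ×
      (UnitaryGroup.cmDatum L 1 (Matrix.of fun i j : Fin 1 => if i.val + j.val + 1 = 1 then (1 : L) else 0)).Local v)) (t : ↥T),
    Φ (QuotientGroup.mk x, t) = x * t * x⁻¹)
  [MeasurableSpace (((UnitaryGroup.cmDatum L 2 (Matrix.of fun i j : Fin 2 => if i.val + j.val + 1 = 2 then (1 : L) else 0)).Local v ×
      (UnitaryGroup.cmDatum L 1 (Matrix.of fun i j : Fin 1 => if i.val + j.val + 1 = 1 then (1 : L) else 0)).Local v))]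
  [BorelSpace (((UnitaryGroup.cmDatum L 2 (Matrix.of fun i j : Fin 2 => if i.val + j.val + 1 = 2 then (1 : L) else 0)).Local v ×
      (UnitaryGroup.cmDatum L 1 (Matrix.of fun i j : Fin 1 => if i.val + j.val + 1 = 1 then (1 : L) else 0)).Local v))]
  [LocallyCompactSpace (((UnitaryGroup.cmDatum L 2 (Matrix.of fun i j : Fin 2 => if i.val + j.val + 1 = 2 then (1 : L) else 0)).Local v ×
      (UnitaryGroup.cmDatum L 1 (Matrix.of fun i j : Fin 1 => if i.val + j.val + 1 = 1 then (1 : L) else 0)).Local v))]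
  [SecondCountableTopology (((UnitaryGroup.cmDatum L 2 (Matrix.of fun i j : Fin 2 => if i.val + j.val + 1 = 2 then (1 : L) else 0)).Local v ×
      (UnitaryGroup.cmDatum L 1 (Matrix.of fun i j : Fin 1 => if i.val + j.val + 1 = 1 then (1 : L) else 0)).Local v))]
  [T2Space (((UnitaryGroup.cmDatum L 2 (Matrix.of fun i j : Fin 2 => if i.val + j.val + 1 = 2 then (1 : L) else 0)).Local v ×
      (UnitaryGroup.cmDatum L 1 (Matrix.of fun i j : Fin 1 => if i.val + j.val + 1 = 1 then (1 : L) else 0)).Local v))]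
  [MeasurableSpace ((((UnitaryGroup.cmDatum L 2 (Matrix.of fun i j : Fin 2 => if i.val + j.val + 1 = 2 then (1 : L) else 0)).Local v ×
      (UnitaryGroup.cmDatum L 1 (Matrix.of fun i j : Fin 1 => if i.val + j.val + 1 = 1 then (1 : L) else 0)).Local v)) ⧸ T)]
  [BorelSpace ((((UnitaryGroup.cmDatum L 2 (Matrix.of fun i j : Fin 2 => if i.val + j.val + 1 = 2 then (1 : L) else 0)).Local v ×
      (UnitaryGroup.cmDatum L 1 (Matrix.of fun i j : Fin 1 => if i.val + j.val + 1 = 1 then (1 : L) else 0)).Local v)) ⧸ T)]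
  (νHv : Measure (((UnitaryGroup.cmDatum L 2 (Matrix.of fun i j : Fin 2 => if i.val + j.val + 1 = 2 then (1 : L) else 0)).Local v ×
      (UnitaryGroup.cmDatum L 1 (Matrix.of fun i j : Fin 1 => if i.val + j.val + 1 = 1 then (1 : L) else 0)).Local v))) [νHv.IsHaarMeasure] [νHv.IsMulRightInvariant]
  (tT : Measure ↥T) [tT.IsMulLeftInvariant] [IsFiniteMeasureOnCompacts tT] [tT.IsOpenPosMeasure] [tT.IsInvInvariant]
  (D : ↥T → ℝ≥0) (hD : Measurable D)

set_option maxHeartbeats 1600000 in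
-- instance-term unification on the CM local carrier, as ★ (H3e)
include hRc hRo hab hZ hW hΦ hD in
/-- **(A0-H) TORUS-SIDE INTEGRABILITY ON `H_v` FROM GROUP-SIDE INTEGRABILITY**: under the local tube-Jacobian socket `hJacLoc` at the Cartan `T = Z_H(γ₀)` of `H_v` with weight `D`
(★ (H3e) §3's letters), if `g : H_v → ℂ` is `νHv`-integrable on the `T`-regular set `H_T = {x s x⁻¹ | s ∈ T, s G-regular}` then **`t ↦ D(t) • ∫_{H_v⧸T} g(Φ(q,t)) d(νHv∕tT)` is
`tT`-integrable on `{t ∈ T | G-regular}`** — the torus term of the (H5) assembler's `hJacInt` letter ∕ ★ `setIntegral_weighted_orbital_eq_smul_setIntegral_cartanSetH` is a genuine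
Bochner integrand. [cite: Rogawski1990, §12.5 pp. 182–183, Lemma 12.5.1] [cite: HarishChandra1970, Lemma 42] -/
theorem integrableOn_weighted_orbital_of_integrableOn_H
    (hJacLoc : ∀ t₀ : ↥T, IsLocalGRegular L v (t₀ : ((UnitaryGroup.cmDatum L 2 (Matrix.of fun i j : Fin 2 => if i.val + j.val + 1 = 2 then (1 : L) else 0)).Local v ×
      (UnitaryGroup.cmDatum L 1 (Matrix.of fun i j : Fin 1 => if i.val + j.val + 1 = 1 then (1 : L) else 0)).Local v)) →
      ∃ U : Set ↥T, IsOpen U ∧ t₀ ∈ U ∧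
        ∃ A₀ : Set ((((UnitaryGroup.cmDatum L 2 (Matrix.of fun i j : Fin 2 => if i.val + j.val + 1 = 2 then (1 : L) else 0)).Local v ×
      (UnitaryGroup.cmDatum L 1 (Matrix.of fun i j : Fin 1 => if i.val + j.val + 1 = 1 then (1 : L) else 0)).Local v)) ⧸ T),
          MeasurableSet A₀ ∧ (quotientMeasure T tT (isClosed_cartanH hT) νHv) A₀ ≠ 0 ∧ (quotientMeasure T tT (isClosed_cartanH hT) νHv) A₀ ≠ ∞ ∧
          ∀ V : Set ↥T, MeasurableSet V → V ⊆ U →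
            (∀ t ∈ V, IsLocalGRegular L v (t : ((UnitaryGroup.cmDatum L 2 (Matrix.of fun i j : Fin 2 => if i.val + j.val + 1 = 2 then (1 : L) else 0)).Local v ×
      (UnitaryGroup.cmDatum L 1 (Matrix.of fun i j : Fin 1 => if i.val + j.val + 1 = 1 then (1 : L) else 0)).Local v))) →
            (∀ n : ((UnitaryGroup.cmDatum L 2 (Matrix.of fun i j : Fin 2 => if i.val + j.val + 1 = 2 then (1 : L) else 0)).Local v ×
      (UnitaryGroup.cmDatum L 1 (Matrix.of fun i j : Fin 1 => if i.val + j.val + 1 = 1 then (1 : L) else 0)).Local v),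
              n ∉ T → ∀ t ∈ V, ∀ t' ∈ V, ((t' : ↥T) : ((UnitaryGroup.cmDatum L 2 (Matrix.of fun i j : Fin 2 => if i.val + j.val + 1 = 2 then (1 : L) else 0)).Local v ×
      (UnitaryGroup.cmDatum L 1 (Matrix.of fun i j : Fin 1 => if i.val + j.val + 1 = 1 then (1 : L) else 0)).Local v)) ≠ n * t * n⁻¹) →
              νHv (Φ '' (A₀ ×ˢ V)) = (quotientMeasure T tT (isClosed_cartanH hT) νHv) A₀ * ∫⁻ t in V, (D t : ℝ≥0∞) ∂tT)
    (g : ((UnitaryGroup.cmDatum L 2 (Matrix.of fun i j : Fin 2 => if i.val + j.val + 1 = 2 then (1 : L) else 0)).Local v ×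
      (UnitaryGroup.cmDatum L 1 (Matrix.of fun i j : Fin 1 => if i.val + j.val + 1 = 1 then (1 : L) else 0)).Local v) → ℂ)
    (hg : IntegrableOn g {x | ∃ g s : ((UnitaryGroup.cmDatum L 2 (Matrix.of fun i j : Fin 2 => if i.val + j.val + 1 = 2 then (1 : L) else 0)).Local v ×
      (UnitaryGroup.cmDatum L 1 (Matrix.of fun i j : Fin 1 => if i.val + j.val + 1 = 1 then (1 : L) else 0)).Local v),
      s ∈ T ∧ IsLocalGRegular L v s ∧ g * s * g⁻¹ = x} νHv) :
    IntegrableOn (fun t : ↥T => (D t : ℝ) • ∫ q, g (Φ (q, t)) ∂(quotientMeasure T tT (isClosed_cartanH hT) νHv))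
      {t : ↥T | IsLocalGRegular L v (t : ((UnitaryGroup.cmDatum L 2 (Matrix.of fun i j : Fin 2 => if i.val + j.val + 1 = 2 then (1 : L) else 0)).Local v ×
      (UnitaryGroup.cmDatum L 1 (Matrix.of fun i j : Fin 1 => if i.val + j.val + 1 = 1 then (1 : L) else 0)).Local v))} tT :=
  integrableOn_weighted_orbital_of_integrableOn (R := {s | IsLocalGRegular L v s}) hRo.measurableSet (fun g x hx => hRc g x hx) (isClosed_cartanH hT) hab hZ hW Φ hΦ
    νHv tT D hD hJacLoc g hg

set_option maxHeartbeats 1600000 in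
-- instance-term unification on the CM local carrier, as ★ (H3e)
include hRc hRo hab hZ hW hΦ hD in
/-- **(A0-H) CLASS-FUNCTION FORM ON `H_v`**: for `fH α : H_v → ℂ` with `α(x s x⁻¹) = α(s)` for `G`-regular `s` and `fH · α` `νHv`-integrable on `H_T`,
**`t ↦ D(t) • (α(t) · ∫_{H_v⧸T} fH(Φ(q,t)) d(νHv∕tT))` is `tT`-integrable on `{t ∈ T | G-regular}`** — the torus term of ★ (H5) `integral_mul_classFun_eq_sum_classOrbitalIntegral_H_of_shape`
before its `hOrb` rewriting. [cite: Rogawski1990, §12.5 pp. 182–183, Lemma 12.5.1] [cite: HarishChandra1970, Lemma 42] -/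
theorem integrableOn_weighted_classFun_mul_orbital_H
    (hJacLoc : ∀ t₀ : ↥T, IsLocalGRegular L v (t₀ : ((UnitaryGroup.cmDatum L 2 (Matrix.of fun i j : Fin 2 => if i.val + j.val + 1 = 2 then (1 : L) else 0)).Local v ×
      (UnitaryGroup.cmDatum L 1 (Matrix.of fun i j : Fin 1 => if i.val + j.val + 1 = 1 then (1 : L) else 0)).Local v)) →
      ∃ U : Set ↥T, IsOpen U ∧ t₀ ∈ U ∧
        ∃ A₀ : Set ((((UnitaryGroup.cmDatum L 2 (Matrix.of fun i j : Fin 2 => if i.val + j.val + 1 = 2 then (1 : L) else 0)).Local v ×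
      (UnitaryGroup.cmDatum L 1 (Matrix.of fun i j : Fin 1 => if i.val + j.val + 1 = 1 then (1 : L) else 0)).Local v)) ⧸ T),
          MeasurableSet A₀ ∧ (quotientMeasure T tT (isClosed_cartanH hT) νHv) A₀ ≠ 0 ∧ (quotientMeasure T tT (isClosed_cartanH hT) νHv) A₀ ≠ ∞ ∧
          ∀ V : Set ↥T, MeasurableSet V → V ⊆ U →
            (∀ t ∈ V, IsLocalGRegular L v (t : ((UnitaryGroup.cmDatum L 2 (Matrix.of fun i j : Fin 2 => if i.val + j.val + 1 = 2 then (1 : L) else 0)).Local v ×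
      (UnitaryGroup.cmDatum L 1 (Matrix.of fun i j : Fin 1 => if i.val + j.val + 1 = 1 then (1 : L) else 0)).Local v))) →
            (∀ n : ((UnitaryGroup.cmDatum L 2 (Matrix.of fun i j : Fin 2 => if i.val + j.val + 1 = 2 then (1 : L) else 0)).Local v ×
      (UnitaryGroup.cmDatum L 1 (Matrix.of fun i j : Fin 1 => if i.val + j.val + 1 = 1 then (1 : L) else 0)).Local v),
              n ∉ T → ∀ t ∈ V, ∀ t' ∈ V, ((t' : ↥T) : ((UnitaryGroup.cmDatum L 2 (Matrix.of fun i j : Fin 2 => if i.val + j.val + 1 = 2 then (1 : L) else 0)).Local v ×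
      (UnitaryGroup.cmDatum L 1 (Matrix.of fun i j : Fin 1 => if i.val + j.val + 1 = 1 then (1 : L) else 0)).Local v)) ≠ n * t * n⁻¹) →
              νHv (Φ '' (A₀ ×ˢ V)) = (quotientMeasure T tT (isClosed_cartanH hT) νHv) A₀ * ∫⁻ t in V, (D t : ℝ≥0∞) ∂tT)
    (fH α : ((UnitaryGroup.cmDatum L 2 (Matrix.of fun i j : Fin 2 => if i.val + j.val + 1 = 2 then (1 : L) else 0)).Local v ×
      (UnitaryGroup.cmDatum L 1 (Matrix.of fun i j : Fin 1 => if i.val + j.val + 1 = 1 then (1 : L) else 0)).Local v) → ℂ)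
    (hα : ∀ x s : ((UnitaryGroup.cmDatum L 2 (Matrix.of fun i j : Fin 2 => if i.val + j.val + 1 = 2 then (1 : L) else 0)).Local v ×
      (UnitaryGroup.cmDatum L 1 (Matrix.of fun i j : Fin 1 => if i.val + j.val + 1 = 1 then (1 : L) else 0)).Local v),
      IsLocalGRegular L v s → α (x * s * x⁻¹) = α s)
    (hfα : IntegrableOn (fun y => fH y * α y) {x | ∃ g s : ((UnitaryGroup.cmDatum L 2 (Matrix.of fun i j : Fin 2 => if i.val + j.val + 1 = 2 then (1 : L) else 0)).Local v ×
      (UnitaryGroup.cmDatum L 1 (Matrix.of fun i j : Fin 1 => if i.val + j.val + 1 = 1 then (1 : L) else 0)).Local v),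
      s ∈ T ∧ IsLocalGRegular L v s ∧ g * s * g⁻¹ = x} νHv) :
    IntegrableOn (fun t : ↥T => (D t : ℝ) • (α (t : ((UnitaryGroup.cmDatum L 2 (Matrix.of fun i j : Fin 2 => if i.val + j.val + 1 = 2 then (1 : L) else 0)).Local v ×
      (UnitaryGroup.cmDatum L 1 (Matrix.of fun i j : Fin 1 => if i.val + j.val + 1 = 1 then (1 : L) else 0)).Local v)) *
        ∫ q, fH (Φ (q, t)) ∂(quotientMeasure T tT (isClosed_cartanH hT) νHv)))
      {t : ↥T | IsLocalGRegular L v (t : ((UnitaryGroup.cmDatum L 2 (Matrix.of fun i j : Fin 2 => if i.val + j.val + 1 = 2 then (1 : L) else 0)).Local v ×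
      (UnitaryGroup.cmDatum L 1 (Matrix.of fun i j : Fin 1 => if i.val + j.val + 1 = 1 then (1 : L) else 0)).Local v))} tT :=
  integrableOn_weighted_classFun_mul_orbital (R := {s | IsLocalGRegular L v s}) hRo.measurableSet (fun g x hx => hRc g x hx) (isClosed_cartanH hT) hab hZ hW Φ hΦ
    νHv tT D hD hJacLoc fH α (fun x s hs => hα x s hs) hfα

end Endoscopic

/-! ## §3 The `ι`-indexed head in the (H5) assembler's currency (`classOrbitalIntegral mHv`, `hOrb` by shape) — the `hIntT` letter of (H6b′) SWIF-H ∕ (A1′) -/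

section Family

variable {L : Type} [Field L] [NumberField L] [IsCMField L] {v : HeightOneSpectrum (𝓞 ↥(maximalRealSubfield L))}
  {ι : Type*} {T : ι → Subgroup (((UnitaryGroup.cmDatum L 2 (Matrix.of fun i j : Fin 2 => if i.val + j.val + 1 = 2 then (1 : L) else 0)).Local v ×
      (UnitaryGroup.cmDatum L 1 (Matrix.of fun i j : Fin 1 => if i.val + j.val + 1 = 1 then (1 : L) else 0)).Local v))}
  {γ : ι → ((UnitaryGroup.cmDatum L 2 (Matrix.of fun i j : Fin 2 => if i.val + j.val + 1 = 2 then (1 : L) else 0)).Local v ×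
      (UnitaryGroup.cmDatum L 1 (Matrix.of fun i j : Fin 1 => if i.val + j.val + 1 = 1 then (1 : L) else 0)).Local v)}
  (hT : ∀ i, T i = Subgroup.centralizer ({γ i} : Set (((UnitaryGroup.cmDatum L 2 (Matrix.of fun i j : Fin 2 => if i.val + j.val + 1 = 2 then (1 : L) else 0)).Local v ×
      (UnitaryGroup.cmDatum L 1 (Matrix.of fun i j : Fin 1 => if i.val + j.val + 1 = 1 then (1 : L) else 0)).Local v))))
  -- (H3b) ∕ (H3a) letters by shape, per representative
  (hRc : ∀ g s : ((UnitaryGroup.cmDatum L 2 (Matrix.of fun i j : Fin 2 => if i.val + j.val + 1 = 2 then (1 : L) else 0)).Local v ×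
      (UnitaryGroup.cmDatum L 1 (Matrix.of fun i j : Fin 1 => if i.val + j.val + 1 = 1 then (1 : L) else 0)).Local v),
    IsLocalGRegular L v s → IsLocalGRegular L v (g * s * g⁻¹))
  (hRo : IsOpen {s : ((UnitaryGroup.cmDatum L 2 (Matrix.of fun i j : Fin 2 => if i.val + j.val + 1 = 2 then (1 : L) else 0)).Local v ×
      (UnitaryGroup.cmDatum L 1 (Matrix.of fun i j : Fin 1 => if i.val + j.val + 1 = 1 then (1 : L) else 0)).Local v) | IsLocalGRegular L v s})
  (hab : ∀ i, ∀ a ∈ T i, ∀ b ∈ T i, a * b = b * a)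
  (hZ : ∀ i (t : ↥(T i)), IsLocalGRegular L v (t : ((UnitaryGroup.cmDatum L 2 (Matrix.of fun i j : Fin 2 => if i.val + j.val + 1 = 2 then (1 : L) else 0)).Local v ×
      (UnitaryGroup.cmDatum L 1 (Matrix.of fun i j : Fin 1 => if i.val + j.val + 1 = 1 then (1 : L) else 0)).Local v)) →
    Subgroup.centralizer ({(t : ((UnitaryGroup.cmDatum L 2 (Matrix.of fun i j : Fin 2 => if i.val + j.val + 1 = 2 then (1 : L) else 0)).Local v ×
      (UnitaryGroup.cmDatum L 1 (Matrix.of fun i j : Fin 1 => if i.val + j.val + 1 = 1 then (1 : L) else 0)).Local v))} : Set _) = T i)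
  (hW : ∀ i, ((T i).subgroupOf (Subgroup.normalizer (T i : Set (((UnitaryGroup.cmDatum L 2 (Matrix.of fun i j : Fin 2 => if i.val + j.val + 1 = 2 then (1 : L) else 0)).Local v ×
      (UnitaryGroup.cmDatum L 1 (Matrix.of fun i j : Fin 1 => if i.val + j.val + 1 = 1 then (1 : L) else 0)).Local v))))).index ≠ 0)
  [MeasurableSpace (((UnitaryGroup.cmDatum L 2 (Matrix.of fun i j : Fin 2 => if i.val + j.val + 1 = 2 then (1 : L) else 0)).Local v ×
      (UnitaryGroup.cmDatum L 1 (Matrix.of fun i j : Fin 1 => if i.val + j.val + 1 = 1 then (1 : L) else 0)).Local v))]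
  [BorelSpace (((UnitaryGroup.cmDatum L 2 (Matrix.of fun i j : Fin 2 => if i.val + j.val + 1 = 2 then (1 : L) else 0)).Local v ×
      (UnitaryGroup.cmDatum L 1 (Matrix.of fun i j : Fin 1 => if i.val + j.val + 1 = 1 then (1 : L) else 0)).Local v))]
  [LocallyCompactSpace (((UnitaryGroup.cmDatum L 2 (Matrix.of fun i j : Fin 2 => if i.val + j.val + 1 = 2 then (1 : L) else 0)).Local v ×
      (UnitaryGroup.cmDatum L 1 (Matrix.of fun i j : Fin 1 => if i.val + j.val + 1 = 1 then (1 : L) else 0)).Local v))]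
  [SecondCountableTopology (((UnitaryGroup.cmDatum L 2 (Matrix.of fun i j : Fin 2 => if i.val + j.val + 1 = 2 then (1 : L) else 0)).Local v ×
      (UnitaryGroup.cmDatum L 1 (Matrix.of fun i j : Fin 1 => if i.val + j.val + 1 = 1 then (1 : L) else 0)).Local v))]
  [T2Space (((UnitaryGroup.cmDatum L 2 (Matrix.of fun i j : Fin 2 => if i.val + j.val + 1 = 2 then (1 : L) else 0)).Local v ×
      (UnitaryGroup.cmDatum L 1 (Matrix.of fun i j : Fin 1 => if i.val + j.val + 1 = 1 then (1 : L) else 0)).Local v))]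
  [∀ i, MeasurableSpace ((((UnitaryGroup.cmDatum L 2 (Matrix.of fun i j : Fin 2 => if i.val + j.val + 1 = 2 then (1 : L) else 0)).Local v ×
      (UnitaryGroup.cmDatum L 1 (Matrix.of fun i j : Fin 1 => if i.val + j.val + 1 = 1 then (1 : L) else 0)).Local v)) ⧸ T i)]
  [∀ i, BorelSpace ((((UnitaryGroup.cmDatum L 2 (Matrix.of fun i j : Fin 2 => if i.val + j.val + 1 = 2 then (1 : L) else 0)).Local v ×
      (UnitaryGroup.cmDatum L 1 (Matrix.of fun i j : Fin 1 => if i.val + j.val + 1 = 1 then (1 : L) else 0)).Local v)) ⧸ T i)]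
  (νHv : Measure (((UnitaryGroup.cmDatum L 2 (Matrix.of fun i j : Fin 2 => if i.val + j.val + 1 = 2 then (1 : L) else 0)).Local v ×
      (UnitaryGroup.cmDatum L 1 (Matrix.of fun i j : Fin 1 => if i.val + j.val + 1 = 1 then (1 : L) else 0)).Local v))) [νHv.IsHaarMeasure] [νHv.IsMulRightInvariant]
  {mHv : OrbitalMeasureFamily (((UnitaryGroup.cmDatum L 2 (Matrix.of fun i j : Fin 2 => if i.val + j.val + 1 = 2 then (1 : L) else 0)).Local v ×
      (UnitaryGroup.cmDatum L 1 (Matrix.of fun i j : Fin 1 => if i.val + j.val + 1 = 1 then (1 : L) else 0)).Local v))}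
  (Φ : ∀ i, ((((UnitaryGroup.cmDatum L 2 (Matrix.of fun i j : Fin 2 => if i.val + j.val + 1 = 2 then (1 : L) else 0)).Local v ×
      (UnitaryGroup.cmDatum L 1 (Matrix.of fun i j : Fin 1 => if i.val + j.val + 1 = 1 then (1 : L) else 0)).Local v)) ⧸ T i) × ↥(T i) →
    ((UnitaryGroup.cmDatum L 2 (Matrix.of fun i j : Fin 2 => if i.val + j.val + 1 = 2 then (1 : L) else 0)).Local v ×
      (UnitaryGroup.cmDatum L 1 (Matrix.of fun i j : Fin 1 => if i.val + j.val + 1 = 1 then (1 : L) else 0)).Local v))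
  (hΦ : ∀ i (x : ((UnitaryGroup.cmDatum L 2 (Matrix.of fun i j : Fin 2 => if i.val + j.val + 1 = 2 then (1 : L) else 0)).Local v ×
      (UnitaryGroup.cmDatum L 1 (Matrix.of fun i j : Fin 1 => if i.val + j.val + 1 = 1 then (1 : L) else 0)).Local v)) (t : ↥(T i)),
    Φ i (QuotientGroup.mk x, t) = x * t * x⁻¹)
  (tT : ∀ i, Measure ↥(T i)) [∀ i, (tT i).IsHaarMeasure] [∀ i, (tT i).IsInvInvariant]
  (D : ∀ i, ↥(T i) → ℝ≥0) (hD : ∀ i, Measurable (D i))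

set_option maxHeartbeats 1600000 in
-- instance-term unification on the CM local carrier (`quotientMeasure` per `i`), as ★ (H5)
include hRc hRo hab hZ hW hΦ hD in
/-- **(A0-H) FOR THE WHOLE `H`-CARTAN FAMILY, IN THE (H5) ASSEMBLER'S CURRENCY** (`T i = Z_H(γ i)`, `t_{T i}` Haar, weights `D i`, the canonical orbital integrals
`classOrbitalIntegral mHv` through the `hOrb` letter BY SHAPE exactly as ★ `F0P3cStCharTSUpTrWIFH.integral_mul_classFun_eq_sum_classOrbitalIntegral_H_of_shape`, closedness witness
★ (H3b) `isClosed_cartan (hT i)`; local tube-Jacobian sockets `hJacLoc i`): for `fH` measurable, `α` a class function on the `G`-regular set and `fH · α` `νHv`-integrable, EVERY torus term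
`t ↦ D i t • (α(t) · classOrbitalIntegral mHv fH ⟦t⟧)` is `t_{T i}`-integrable on `{t ∈ T i | G-regular}` — the `hIntT` letter of (H6b′) SWIF-H, token for token.
[cite: Rogawski1990, §12.5 pp. 182–183, Lemma 12.5.1] [cite: HarishChandra1970, Lemma 42] -/
theorem integrableOn_weighted_classOrbitalIntegral_of_integrable_H
    (hJacLoc : ∀ i, ∀ t₀ : ↥(T i), IsLocalGRegular L v (t₀ : ((UnitaryGroup.cmDatum L 2 (Matrix.of fun i j : Fin 2 => if i.val + j.val + 1 = 2 then (1 : L) else 0)).Local v ×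
      (UnitaryGroup.cmDatum L 1 (Matrix.of fun i j : Fin 1 => if i.val + j.val + 1 = 1 then (1 : L) else 0)).Local v)) →
      ∃ U : Set ↥(T i), IsOpen U ∧ t₀ ∈ U ∧
        ∃ A₀ : Set ((((UnitaryGroup.cmDatum L 2 (Matrix.of fun i j : Fin 2 => if i.val + j.val + 1 = 2 then (1 : L) else 0)).Local v ×
      (UnitaryGroup.cmDatum L 1 (Matrix.of fun i j : Fin 1 => if i.val + j.val + 1 = 1 then (1 : L) else 0)).Local v)) ⧸ T i),
          MeasurableSet A₀ ∧ (quotientMeasure (T i) (tT i) (F0P3cStCharTSUpTrCartanFields.isClosed_cartan (hT i)) νHv) A₀ ≠ 0 ∧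
          (quotientMeasure (T i) (tT i) (F0P3cStCharTSUpTrCartanFields.isClosed_cartan (hT i)) νHv) A₀ ≠ ∞ ∧
          ∀ V : Set ↥(T i), MeasurableSet V → V ⊆ U →
            (∀ t ∈ V, IsLocalGRegular L v (t : ((UnitaryGroup.cmDatum L 2 (Matrix.of fun i j : Fin 2 => if i.val + j.val + 1 = 2 then (1 : L) else 0)).Local v ×
      (UnitaryGroup.cmDatum L 1 (Matrix.of fun i j : Fin 1 => if i.val + j.val + 1 = 1 then (1 : L) else 0)).Local v))) →
            (∀ n : ((UnitaryGroup.cmDatum L 2 (Matrix.of fun i j : Fin 2 => if i.val + j.val + 1 = 2 then (1 : L) else 0)).Local v ×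
      (UnitaryGroup.cmDatum L 1 (Matrix.of fun i j : Fin 1 => if i.val + j.val + 1 = 1 then (1 : L) else 0)).Local v),
              n ∉ T i → ∀ t ∈ V, ∀ t' ∈ V, ((t' : ↥(T i)) : ((UnitaryGroup.cmDatum L 2 (Matrix.of fun i j : Fin 2 => if i.val + j.val + 1 = 2 then (1 : L) else 0)).Local v ×
      (UnitaryGroup.cmDatum L 1 (Matrix.of fun i j : Fin 1 => if i.val + j.val + 1 = 1 then (1 : L) else 0)).Local v)) ≠ n * t * n⁻¹) →
              νHv (Φ i '' (A₀ ×ˢ V)) = (quotientMeasure (T i) (tT i) (F0P3cStCharTSUpTrCartanFields.isClosed_cartan (hT i)) νHv) A₀ * ∫⁻ t in V, (D i t : ℝ≥0∞) ∂(tT i))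
    (hOrb : ∀ i (t : ↥(T i)), IsLocalGRegular L v (t : ((UnitaryGroup.cmDatum L 2 (Matrix.of fun i j : Fin 2 => if i.val + j.val + 1 = 2 then (1 : L) else 0)).Local v ×
      (UnitaryGroup.cmDatum L 1 (Matrix.of fun i j : Fin 1 => if i.val + j.val + 1 = 1 then (1 : L) else 0)).Local v)) →
      ∀ φ : ((UnitaryGroup.cmDatum L 2 (Matrix.of fun i j : Fin 2 => if i.val + j.val + 1 = 2 then (1 : L) else 0)).Local v ×
      (UnitaryGroup.cmDatum L 1 (Matrix.of fun i j : Fin 1 => if i.val + j.val + 1 = 1 then (1 : L) else 0)).Local v) → ℂ, Measurable φ →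
      classOrbitalIntegral mHv φ (ConjClasses.mk (t : ((UnitaryGroup.cmDatum L 2 (Matrix.of fun i j : Fin 2 => if i.val + j.val + 1 = 2 then (1 : L) else 0)).Local v ×
      (UnitaryGroup.cmDatum L 1 (Matrix.of fun i j : Fin 1 => if i.val + j.val + 1 = 1 then (1 : L) else 0)).Local v))) =
        ∫ q, φ (Φ i (q, t)) ∂(quotientMeasure (T i) (tT i) (F0P3cStCharTSUpTrCartanFields.isClosed_cartan (hT i)) νHv))
    (fH α : ((UnitaryGroup.cmDatum L 2 (Matrix.of fun i j : Fin 2 => if i.val + j.val + 1 = 2 then (1 : L) else 0)).Local v ×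
      (UnitaryGroup.cmDatum L 1 (Matrix.of fun i j : Fin 1 => if i.val + j.val + 1 = 1 then (1 : L) else 0)).Local v) → ℂ) (hf : Measurable fH)
    (hα : ∀ x t : ((UnitaryGroup.cmDatum L 2 (Matrix.of fun i j : Fin 2 => if i.val + j.val + 1 = 2 then (1 : L) else 0)).Local v ×
      (UnitaryGroup.cmDatum L 1 (Matrix.of fun i j : Fin 1 => if i.val + j.val + 1 = 1 then (1 : L) else 0)).Local v),
      IsLocalGRegular L v t → α (x * t * x⁻¹) = α t)
    (hfα : Integrable (fun y => fH y * α y) νHv) (i : ι) :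
    IntegrableOn (fun t : ↥(T i) => (D i t : ℝ) • (α (t : ((UnitaryGroup.cmDatum L 2 (Matrix.of fun i j : Fin 2 => if i.val + j.val + 1 = 2 then (1 : L) else 0)).Local v ×
      (UnitaryGroup.cmDatum L 1 (Matrix.of fun i j : Fin 1 => if i.val + j.val + 1 = 1 then (1 : L) else 0)).Local v)) *
        classOrbitalIntegral mHv fH (ConjClasses.mk (t : ((UnitaryGroup.cmDatum L 2 (Matrix.of fun i j : Fin 2 => if i.val + j.val + 1 = 2 then (1 : L) else 0)).Local v ×
      (UnitaryGroup.cmDatum L 1 (Matrix.of fun i j : Fin 1 => if i.val + j.val + 1 = 1 then (1 : L) else 0)).Local v)))))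
      {t : ↥(T i) | IsLocalGRegular L v (t : ((UnitaryGroup.cmDatum L 2 (Matrix.of fun i j : Fin 2 => if i.val + j.val + 1 = 2 then (1 : L) else 0)).Local v ×
      (UnitaryGroup.cmDatum L 1 (Matrix.of fun i j : Fin 1 => if i.val + j.val + 1 = 1 then (1 : L) else 0)).Local v))} (tT i) := by
  have h1 := integrableOn_weighted_classFun_mul_orbital_H (hT i) hRc hRo (hab i) (hZ i) (hW i) (Φ i) (hΦ i) νHv (tT i) (D i) (hD i) (hJacLoc i) fH α hα
    hfα.integrableOn
  have hSm : MeasurableSet {t : ↥(T i) | IsLocalGRegular L v (t : ((UnitaryGroup.cmDatum L 2 (Matrix.of fun i j : Fin 2 => if i.val + j.val + 1 = 2 then (1 : L) else 0)).Local v ×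
      (UnitaryGroup.cmDatum L 1 (Matrix.of fun i j : Fin 1 => if i.val + j.val + 1 = 1 then (1 : L) else 0)).Local v))} :=
    (hRo.preimage continuous_subtype_val).measurableSet
  refine h1.congr_fun (fun t ht => ?_) hSm
  show (D i t : ℝ) • (α (t : ((UnitaryGroup.cmDatum L 2 (Matrix.of fun i j : Fin 2 => if i.val + j.val + 1 = 2 then (1 : L) else 0)).Local v ×
      (UnitaryGroup.cmDatum L 1 (Matrix.of fun i j : Fin 1 => if i.val + j.val + 1 = 1 then (1 : L) else 0)).Local v)) *
      ∫ q, fH (Φ i (q, t)) ∂(quotientMeasure (T i) (tT i) (isClosed_cartanH (hT i)) νHv)) = _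
  rw [hOrb i t ht fH hf]

end Family

end Summit.HodgeConjecture.HodgeConjecture.Cruxes.H413.F0P3cStCharTSUpTrTorusIntegrableH

end
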